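import Summits.NavierStokesRegularity.NavierStokesRegularity.Theorems.StrainDoorsFineStructure
import Literature.Analysis.FluidPDE.LeraySeparationOfEnergyTools
import Literature.Analysis.FluidPDE.NormalisedPressureLpClass
import Literature.Analysis.FluidPDE.NSWeakStrongUniquenessProofs
import Literature.Analysis.FluidPDE.WholeSpaceIBP
import Mathlib.MeasureTheory.Function.L2Space
import HarnessLib

/-!
# StrainDoorsLocalNewtonB3 — ★ atom B3 «HessSmoothingEnergyBound» PROVED; doors D8 «LocalNewtonParityDoor» and D8′ «FineStructureParityDoor» CLOSED BY NAME

ROUND-45 door D8 (`Theorems/StrainDoorsLocalNewton`, nsreg-p1 g33 Sketch47 v8 §12, landed by the LEAD S-door p679552) rests on the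
single NS-free atom B3: for `0 < r₀ < r₁` there is `C = C(r₀,r₁)` with
`|∫ λ_ee(z)·ϖ(v)(x − z) dz| ≤ C·(‖v‖₂² + ‖∇v‖₂²)` for every `H^∞` field `v`, all `x` and unit `e`, where `λ_ee = ∂ₑ∂ₑλ`
(`smoothingHessKernel`, `λ = newtonFarLaplacian r₀ r₁` smooth with compact support) and `ϖ(v) = normalisedPressure v` (Tao's
Riesz-transform pressure). PROOF (all `L²`, fixed-time harmonic analysis): `|λ_ee| ≤ M := sup‖D²λ‖` with support in `K = tsupport λ`
uniformly in unit `e`; Cauchy–Schwarz `|∫ λ_ee(x−w)ϖ(w) dw| ≤ (M²|K|)^{1/2}‖ϖ‖₂`; Stein/Calderón–Zygmund `‖ϖ(v)‖₂ ≤ C_S‖v‖₄²`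
(tree `exists_eLpNorm_normalisedPressure_le_sq`, `p = 2`); Sobolev
`‖v‖₆ ≤ C₆‖∇v‖₂` (tree `exists_eLpNorm_six_le_of_hasWeakGradient_euclidean` with the classical gradient as weak gradient,
`hasWeakGradient_fderiv_of_contDiff`); interpolation `‖v‖₄⁴ ≤ ‖v‖₂‖v‖₆³` (tree `eLpNorm_four_pow_four_le`) and
`max(A,D) ≤ A + D`, all in `[0,∞]` and converted to real numbers at the end. Hence ★ `hessSmoothingEnergyBound_holds` and the
by-name closers ★★ `localNewtonParityDoor_holds : LocalNewtonParityDoor := localNewtonParityDoor_of_B3 hessSmoothingEnergyBound_holds`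
(door D8, ROUND-45) and ★★ `fineStructureParityDoor_holds : FineStructureParityDoor` (door D8′, ROUND-46, `fineStructureParityDoor_of_B3`).
Everything proved; no named facts as hypotheses (the tree's Stein/Sobolev theorems are THEOREMS); `--supports stmt-NavierStokesRegularity-0056
--as helper` (ns-s29-p2 g5; LEAD S-door ns-s30-p1 g4 hand 2026-08-28T23:51:54Z).

HONEST FRAME: a true harmonic-analysis atom and the resulting closure of a CONDITIONAL regularity criterion (door D8 = D5 with the
near-field Newton feed as hypothesis and the smoothing term budgeted a priori by energy + dissipation); items 0056 `NoTypeII`, 10661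
and NS regularity are NOT proved; nothing here is a route or a summit statement.
-/

noncomputable section

open MeasureTheory Set Function Filter Metric Real InnerProductSpace
open _root_.Topology
open scoped RealInnerProductSpace ContDiff ENNReal NNReal
open Literature.Analysis Literature.Analysis.FluidPDE

set_option linter.dupNamespace false

namespace Summit.NavierStokesRegularity.NavierStokesRegularity.Theorems.StrainDoors

/-! ## §1 The Hessian smoothing kernel: bounded, uniformly in the unit direction, and supported in `tsupport λ` -/

/-- `λ_ee(z) = D²λ(z)(e,e)`. -/
theorem smoothingHessKernel_eq {r₀ r₁ : ℝ} (hr₀ : 0 < r₀) (hr₁ : r₀ < r₁) (e z : EuclideanSpace ℝ (Fin 3)) :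
    smoothingHessKernel r₀ r₁ e z = fderiv ℝ (fderiv ℝ (newtonFarLaplacian r₀ r₁)) z e e := by
  unfold smoothingHessKernel
  have hD : DifferentiableAt ℝ (fderiv ℝ (newtonFarLaplacian r₀ r₁)) z :=
    (((contDiff_newtonFarLaplacian hr₀ hr₁ (n := 2)).fderiv_right (m := 1) (by norm_num)).differentiable
      one_ne_zero) z
  rw [fderiv_clm_apply hD (differentiableAt_const e)]
  simp

/-- ONE bound for `|λ_ee(z)|`, all unit `e` and all `z` (the Hessian of the compactly supported smooth `λ` is bounded). -/
theorem exists_abs_smoothingHessKernel_le {r₀ r₁ : ℝ} (hr₀ : 0 < r₀) (hr₁ : r₀ < r₁) :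
    ∃ M : ℝ, 0 ≤ M ∧ ∀ e : EuclideanSpace ℝ (Fin 3), ‖e‖ = 1 → ∀ z, |smoothingHessKernel r₀ r₁ e z| ≤ M := by
  set L := newtonFarLaplacian r₀ r₁ with hL
  have hL2 : ContDiff ℝ 2 L := contDiff_newtonFarLaplacian hr₀ hr₁ (n := 2)
  have hcont : Continuous (iteratedFDeriv ℝ 2 L) := hL2.continuous_iteratedFDeriv le_rfl
  have hsupp : HasCompactSupport (iteratedFDeriv ℝ 2 L) :=
    (hasCompactSupport_newtonFarLaplacian hr₀.le hr₁).iteratedFDeriv 2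
  obtain ⟨C, hC⟩ := hsupp.isCompact.exists_bound_of_continuousOn hcont.continuousOn
  refine ⟨max C 0, le_max_right _ _, fun e he z => ?_⟩
  have hzb : ‖iteratedFDeriv ℝ 2 L z‖ ≤ max C 0 := by
    by_cases hz : z ∈ tsupport (iteratedFDeriv ℝ 2 L)
    · exact (hC z hz).trans (le_max_left _ _)
    · rw [image_eq_zero_of_notMem_tsupport hz, norm_zero]; exact le_max_right _ _
  have hrepr : smoothingHessKernel r₀ r₁ e z = iteratedFDeriv ℝ 2 L z ![e, e] := by
    rw [smoothingHessKernel_eq hr₀ hr₁, iteratedFDeriv_two_apply]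
    rfl
  rw [hrepr, ← Real.norm_eq_abs]
  calc ‖iteratedFDeriv ℝ 2 L z ![e, e]‖ ≤ ‖iteratedFDeriv ℝ 2 L z‖ * ∏ i : Fin 2, ‖(![e, e] : Fin 2 → _) i‖ :=
        ContinuousMultilinearMap.le_opNorm _ _
    _ = ‖iteratedFDeriv ℝ 2 L z‖ := by simp [Fin.prod_univ_two, he]
    _ ≤ max C 0 := hzb

/-- `λ_ee` vanishes off `tsupport λ`. -/
theorem smoothingHessKernel_eq_zero_of_notMem {r₀ r₁ : ℝ} (e : EuclideanSpace ℝ (Fin 3)) {z : EuclideanSpace ℝ (Fin 3)}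
    (hz : z ∉ tsupport (newtonFarLaplacian r₀ r₁)) : smoothingHessKernel r₀ r₁ e z = 0 := by
  unfold smoothingHessKernel
  have hsub : tsupport (fun w => fderiv ℝ (newtonFarLaplacian r₀ r₁) w e) ⊆ tsupport (newtonFarLaplacian r₀ r₁) := by
    refine (closure_mono ?_).trans (tsupport_fderiv_subset ℝ)
    intro w hw h0
    exact hw (show fderiv ℝ (newtonFarLaplacian r₀ r₁) w e = 0 by rw [h0]; rfl)
  rw [fderiv_of_notMem_tsupport ℝ (fun h => hz (hsub h))]
  rfl

/-- `λ_ee` is continuous. -/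
theorem continuous_smoothingHessKernel {r₀ r₁ : ℝ} (hr₀ : 0 < r₀) (hr₁ : r₀ < r₁) (e : EuclideanSpace ℝ (Fin 3)) :
    Continuous (smoothingHessKernel r₀ r₁ e) := by
  unfold smoothingHessKernel
  exact ((contDiff_fderiv_newtonFarLaplacian_apply hr₀ hr₁ e).continuous_fderiv one_ne_zero).clm_apply continuous_const

/-- the squared `L²` mass of the translated kernel: `∫ λ_ee(x−w)² dw ≤ M²·|tsupport λ|`, uniformly in `x` and unit `e`. -/
theorem integral_sq_smoothingHessKernel_sub_le {r₀ r₁ : ℝ} (hr₀ : 0 < r₀) (hr₁ : r₀ < r₁) {M : ℝ}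
    (hM : ∀ e : EuclideanSpace ℝ (Fin 3), ‖e‖ = 1 → ∀ z, |smoothingHessKernel r₀ r₁ e z| ≤ M)
    {e : EuclideanSpace ℝ (Fin 3)} (he : ‖e‖ = 1) (x : EuclideanSpace ℝ (Fin 3)) :
    ∫ w, (smoothingHessKernel r₀ r₁ e (x - w)) ^ 2 ≤
      M ^ 2 * volume.real (tsupport (newtonFarLaplacian r₀ r₁)) := by
  set K := tsupport (newtonFarLaplacian r₀ r₁) with hK
  have hKc : IsCompact K := hasCompactSupport_newtonFarLaplacian hr₀.le hr₁
  rw [integral_sub_left_eq_self (fun w => (smoothingHessKernel r₀ r₁ e w) ^ 2) volume x]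
  have hzero : (fun w => (smoothingHessKernel r₀ r₁ e w) ^ 2) =
      K.indicator (fun w => (smoothingHessKernel r₀ r₁ e w) ^ 2) := by
    funext w
    by_cases hw : w ∈ K
    · rw [Set.indicator_of_mem hw]
    · rw [Set.indicator_of_notMem hw, smoothingHessKernel_eq_zero_of_notMem e hw, zero_pow two_ne_zero]
  rw [hzero, integral_indicator hKc.measurableSet]
  have hfin : IsFiniteMeasure (volume.restrict K) :=
    ⟨by rw [Measure.restrict_apply_univ]; exact hKc.measure_lt_top⟩
  have hf : IntegrableOn (fun w => (smoothingHessKernel r₀ r₁ e w) ^ 2) K volume :=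
    ((continuous_smoothingHessKernel hr₀ hr₁ e).pow 2).continuousOn.integrableOn_compact hKc
  have hg : IntegrableOn (fun _ : EuclideanSpace ℝ (Fin 3) => M ^ 2) K volume := integrable_const _
  calc ∫ w in K, (smoothingHessKernel r₀ r₁ e w) ^ 2 ≤ ∫ w in K, M ^ 2 := by
        refine setIntegral_mono_on hf hg hKc.measurableSet fun w _ => ?_
        rw [← sq_abs]
        exact pow_le_pow_left₀ (abs_nonneg _) (hM e he w) 2
    _ = M ^ 2 * volume.real K := by rw [setIntegral_const, smul_eq_mul, mul_comm]

/-! ## §2 Lebesgue-class facts for an `H^∞` field: `v ∈ L²`, `∇v ∈ L²` (operator and Frobenius norms) -/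

section Field

variable {v : EuclideanSpace ℝ (Fin 3) → EuclideanSpace ℝ (Fin 3)}

/-- `∫ ‖v‖² < ∞` in `[0, ∞]`, from the `n = 0` Sobolev hypothesis of the atom. -/
theorem lintegral_enorm_sq_lt_top_of_sobolev (hH : ∀ n : ℕ, ∫⁻ x, ‖iteratedFDeriv ℝ n v x‖ₑ ^ 2 < ⊤) :
    ∫⁻ x, ‖v x‖ₑ ^ 2 < ⊤ := by
  have h := hH 0
  have e : ∀ x, ‖iteratedFDeriv ℝ 0 v x‖ₑ = ‖v x‖ₑ := fun x => by
    rw [← ofReal_norm, norm_iteratedFDeriv_zero, ofReal_norm]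
  simp_rw [e] at h
  exact h

/-- `∫ ‖∇v‖² < ∞` (operator norm) in `[0, ∞]`, from the `n = 1` Sobolev hypothesis of the atom. -/
theorem lintegral_enorm_fderiv_sq_lt_top_of_sobolev (hH : ∀ n : ℕ, ∫⁻ x, ‖iteratedFDeriv ℝ n v x‖ₑ ^ 2 < ⊤) :
    ∫⁻ x, ‖fderiv ℝ v x‖ₑ ^ 2 < ⊤ := by
  have h := hH 1
  have e : ∀ x, ‖iteratedFDeriv ℝ 1 v x‖ₑ = ‖fderiv ℝ v x‖ₑ := fun x => by
    rw [← ofReal_norm, norm_iteratedFDeriv_one, ofReal_norm]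
  simp_rw [e] at h
  exact h

/-- the Frobenius dissipation is finite: `∫ |∇v|²_F ≤ 3 ∫ ‖∇v‖² < ∞`. -/
theorem lintegral_frobeniusNormSq_fderiv_lt_top_of_sobolev
    (hH : ∀ n : ℕ, ∫⁻ x, ‖iteratedFDeriv ℝ n v x‖ₑ ^ 2 < ⊤) :
    ∫⁻ x, ENNReal.ofReal (frobeniusNormSq (fderiv ℝ v x)) < ⊤ :=
  calc ∫⁻ x, ENNReal.ofReal (frobeniusNormSq (fderiv ℝ v x))
      ≤ ∫⁻ x, 3 * ‖fderiv ℝ v x‖ₑ ^ 2 := lintegral_mono fun _ => ofReal_frobeniusNormSq_le_three_mul_enorm_sq _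
    _ = 3 * ∫⁻ x, ‖fderiv ℝ v x‖ₑ ^ 2 := lintegral_const_mul' _ _ ENNReal.ofNat_ne_top
    _ < ⊤ := ENNReal.mul_lt_top ENNReal.ofNat_lt_top (lintegral_enorm_fderiv_sq_lt_top_of_sobolev hH)

/-- `v ∈ L²`. -/
theorem memLp_two_of_sobolev (hv : ContDiff ℝ ∞ v) (hH : ∀ n : ℕ, ∫⁻ x, ‖iteratedFDeriv ℝ n v x‖ₑ ^ 2 < ⊤) :
    MemLp v 2 volume := by
  refine ⟨hv.continuous.aestronglyMeasurable, ?_⟩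
  rw [eLpNorm_lt_top_iff_lintegral_rpow_enorm_lt_top two_ne_zero ENNReal.ofNat_ne_top, ENNReal.toReal_ofNat]
  simpa only [ENNReal.rpow_two] using lintegral_enorm_sq_lt_top_of_sobolev hH

/-- the energy as a Bochner integral: `∫ ‖v‖² = (∫⁻ ‖v‖ₑ²).toReal`. -/
theorem integral_sq_norm_eq_toReal_of_continuous (hv : Continuous v) :
    (∫ y, ‖v y‖ ^ 2) = (∫⁻ y, ‖v y‖ₑ ^ 2).toReal := by
  rw [integral_eq_lintegral_of_nonneg_ae (Eventually.of_forall fun y => sq_nonneg _)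
    ((hv.norm).pow 2).aestronglyMeasurable]
  congr 1
  refine lintegral_congr fun y => ?_
  rw [ENNReal.ofReal_pow (norm_nonneg _), ofReal_norm]

/-- the dissipation as a Bochner integral: `gradNormSq v = (∫⁻ |∇v|²_F).toReal` for `C¹` fields. -/
theorem gradNormSq_eq_toReal_of_contDiff (hv : ContDiff ℝ 1 v) :
    VectorCalculus.gradNormSq v = (∫⁻ y, ENNReal.ofReal (frobeniusNormSq (fderiv ℝ v y))).toReal := by
  unfold VectorCalculus.gradNormSq
  exact integral_eq_lintegral_of_nonneg_ae (Eventually.of_forall fun y => frobeniusNormSq_nonneg _)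
    (LerayHopfProofs.continuous_frobeniusNormSq.comp (hv.continuous_fderiv one_ne_zero)).aestronglyMeasurable

end Field

/-! ## §3 The three `L²` pieces: `‖v‖₄² ≲ energy`, `‖ϖ(v)‖₂ ≲ energy`, `‖λ_ee‖₂ ≤ Mk`, and the pairing -/

/-- **`‖v‖²_{L⁴} ≲ ∫‖v‖² + ∫|∇v|²_F`**: ONE finite constant `C₄` with `v ∈ L⁴` and
`‖v‖²_{L⁴} ≤ C₄·(∫⁻‖v‖ₑ² + ∫⁻|∇v|²_F)` for every `H^∞` field (interpolation `‖v‖₄⁴ ≤ ‖v‖₂‖v‖₆³`, Sobolev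
`‖v‖₆ ≤ C₆‖∇v‖₂`, and `max(A,D) ≤ A + D`). -/
theorem exists_eLpNorm_four_sq_le_energy :
    ∃ C₄ : ℝ≥0∞, C₄ ≠ ⊤ ∧ ∀ v : EuclideanSpace ℝ (Fin 3) → EuclideanSpace ℝ (Fin 3), ContDiff ℝ ∞ v →
      (∀ n : ℕ, ∫⁻ x, ‖iteratedFDeriv ℝ n v x‖ₑ ^ 2 < ⊤) →
        MemLp v 4 volume ∧ eLpNorm v 4 volume ^ 2 ≤
          C₄ * ((∫⁻ y, ‖v y‖ₑ ^ 2) + ∫⁻ y, ENNReal.ofReal (frobeniusNormSq (fderiv ℝ v y))) := by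
  obtain ⟨C₆, hC₆⟩ := exists_eLpNorm_six_le_of_hasWeakGradient_euclidean
  obtain ⟨C', hC'⟩ : ∃ C' : ℝ≥0∞, C' = ((C₆ : ℝ≥0∞) ^ 3) ^ (1 / 4 : ℝ) := ⟨_, rfl⟩
  have hC'_top : C' ≠ ⊤ := by
    rw [hC']
    exact ENNReal.rpow_ne_top_of_nonneg (by norm_num) (ENNReal.pow_ne_top ENNReal.coe_ne_top)
  have hC'4 : C' ^ 4 = (C₆ : ℝ≥0∞) ^ 3 := by
    rw [hC', ← ENNReal.rpow_natCast _ 4, ← ENNReal.rpow_mul]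
    norm_num
  refine ⟨C' ^ 2, ENNReal.pow_ne_top hC'_top, fun v hv hH => ?_⟩
  obtain ⟨A, hA⟩ : ∃ A : ℝ≥0∞, A = ∫⁻ y, ‖v y‖ₑ ^ 2 := ⟨_, rfl⟩
  obtain ⟨D, hD⟩ : ∃ D : ℝ≥0∞, D = ∫⁻ y, ENNReal.ofReal (frobeniusNormSq (fderiv ℝ v y)) := ⟨_, rfl⟩
  rw [← hA, ← hD]
  have hv1 : ContDiff ℝ 1 v := contDiff_infty.1 hv 1
  have hvm : AEStronglyMeasurable v volume := hv.continuous.aestronglyMeasurable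
  have hA_top : A ≠ ⊤ := by
    rw [hA]
    exact (lintegral_enorm_sq_lt_top_of_sobolev hH).ne
  have hD_top : D ≠ ⊤ := by
    rw [hD]
    exact (lintegral_frobeniusNormSq_fderiv_lt_top_of_sobolev hH).ne
  obtain ⟨t, ht⟩ : ∃ t : ℝ≥0∞, t = (max A D) ^ (1 / 2 : ℝ) := ⟨_, rfl⟩
  have ht_top : t ≠ ⊤ := by
    rw [ht]
    exact ENNReal.rpow_ne_top_of_nonneg (by norm_num) (max_lt hA_top.lt_top hD_top.lt_top).ne
  have ht2 : t ^ 2 = max A D := by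
    rw [ht, ← ENNReal.rpow_natCast _ 2, ← ENNReal.rpow_mul]
    norm_num
  have hs2sq : eLpNorm v 2 volume ^ 2 = A := by
    rw [hA, eLpNorm_eq_lintegral_rpow_enorm_toReal two_ne_zero ENNReal.ofNat_ne_top, ENNReal.toReal_ofNat,
      ← ENNReal.rpow_natCast _ 2, ← ENNReal.rpow_mul]
    norm_num
  -- `‖v‖₂ ≤ t`, `‖v‖₆ ≤ C₆ t` (Sobolev), hence `‖v‖₄ ≤ C' t` (interpolation)
  have hs2 : eLpNorm v 2 volume ≤ t :=
    calc eLpNorm v 2 volume = (eLpNorm v 2 volume ^ 2) ^ (1 / 2 : ℝ) := by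
          rw [← ENNReal.rpow_natCast _ 2, ← ENNReal.rpow_mul]
          norm_num
      _ ≤ t := by
          rw [ht]
          exact ENNReal.rpow_le_rpow (hs2sq.le.trans (le_max_left A D)) (by norm_num)
  have hs6 : eLpNorm v 6 volume ≤ C₆ * t := by
    have h := hC₆ v (fderiv ℝ v) (memLp_two_of_sobolev hv hH) (hasWeakGradient_fderiv_of_contDiff hv1)
    rw [← hD] at h
    rw [ht]
    exact h.trans (mul_le_mul' le_rfl (ENNReal.rpow_le_rpow (le_max_right A D) (by norm_num)))
  have hs44 : eLpNorm v 4 volume ^ 4 ≤ (C' * t) ^ 4 :=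
    calc eLpNorm v 4 volume ^ 4 ≤ eLpNorm v 2 volume * eLpNorm v 6 volume ^ 3 := eLpNorm_four_pow_four_le hvm
      _ ≤ t * (C₆ * t) ^ 3 := by gcongr
      _ = (C' * t) ^ 4 := by rw [mul_pow C' t 4, hC'4]; ring
  have hs4 : eLpNorm v 4 volume ≤ C' * t :=
    calc eLpNorm v 4 volume = (eLpNorm v 4 volume ^ 4) ^ (1 / 4 : ℝ) := by
          rw [← ENNReal.rpow_natCast _ 4, ← ENNReal.rpow_mul]
          norm_num
      _ ≤ ((C' * t) ^ 4) ^ (1 / 4 : ℝ) := ENNReal.rpow_le_rpow hs44 (by norm_num)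
      _ = C' * t := by
          rw [← ENNReal.rpow_natCast _ 4, ← ENNReal.rpow_mul]
          norm_num
  refine ⟨⟨hvm, hs4.trans_lt (ENNReal.mul_lt_top hC'_top.lt_top ht_top.lt_top)⟩, ?_⟩
  calc eLpNorm v 4 volume ^ 2 ≤ (C' * t) ^ 2 := by gcongr
    _ = C' ^ 2 * max A D := by rw [mul_pow, ht2]
    _ ≤ C' ^ 2 * (A + D) := mul_le_mul' le_rfl (max_le le_self_add le_add_self)

/-- **Stein in the energy frame**: ONE finite constant `Cp` with `ϖ(v) ∈ L²` and
`‖ϖ(v)‖_{L²} ≤ Cp·(∫⁻‖v‖ₑ² + ∫⁻|∇v|²_F)` for every `H^∞` field (`‖ϖ(v)‖₂ ≤ C_S‖v‖₄²`, tree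
`exists_eLpNorm_normalisedPressure_le_sq` with `p = 2`, and `exists_eLpNorm_four_sq_le_energy`). -/
theorem exists_eLpNorm_normalisedPressure_two_le_energy :
    ∃ Cp : ℝ≥0∞, Cp ≠ ⊤ ∧ ∀ v : EuclideanSpace ℝ (Fin 3) → EuclideanSpace ℝ (Fin 3), ContDiff ℝ ∞ v →
      (∀ n : ℕ, ∫⁻ x, ‖iteratedFDeriv ℝ n v x‖ₑ ^ 2 < ⊤) →
        MemLp (normalisedPressure v) 2 volume ∧ eLpNorm (normalisedPressure v) 2 volume ≤
          Cp * ((∫⁻ y, ‖v y‖ₑ ^ 2) + ∫⁻ y, ENNReal.ofReal (frobeniusNormSq (fderiv ℝ v y))) := by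
  obtain ⟨CS, hCS⟩ := exists_eLpNorm_normalisedPressure_le_sq (p := 2) ENNReal.one_lt_two ENNReal.ofNat_lt_top
  obtain ⟨C₄, hC₄_top, hC₄⟩ := exists_eLpNorm_four_sq_le_energy
  have h22 : (2 : ℝ≥0∞) * 2 = 4 := by norm_num
  refine ⟨CS * C₄, ENNReal.mul_ne_top ENNReal.coe_ne_top hC₄_top, fun v hv hH => ?_⟩
  obtain ⟨hv4, hle⟩ := hC₄ v hv hH
  have hv22 : MemLp v (2 * 2) volume := by
    rw [h22]
    exact hv4
  refine ⟨memLp_normalisedPressure_of_memLp_two_mul (p := 2) ENNReal.one_lt_two ENNReal.ofNat_lt_top hv22, ?_⟩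
  have h := hCS v hv22
  rw [h22] at h
  calc eLpNorm (normalisedPressure v) 2 volume ≤ CS * eLpNorm v 4 volume ^ 2 := h
    _ ≤ CS * (C₄ * ((∫⁻ y, ‖v y‖ₑ ^ 2) + ∫⁻ y, ENNReal.ofReal (frobeniusNormSq (fderiv ℝ v y)))) :=
      mul_le_mul' le_rfl hle
    _ = CS * C₄ * ((∫⁻ y, ‖v y‖ₑ ^ 2) + ∫⁻ y, ENNReal.ofReal (frobeniusNormSq (fderiv ℝ v y))) :=
      (mul_assoc _ _ _).symm

/-- the kernel in `L²`: ONE finite `Mk = Mk(r₀,r₁)` with `‖λ_ee‖_{L²} ≤ Mk` for every unit `e` (`|λ_ee| ≤ M` on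
`K = tsupport λ` and `λ_ee = 0` off `K`, so `‖λ_ee‖₂ ≤ M·|K|^{1/2}`). -/
theorem exists_eLpNorm_smoothingHessKernel_le {r₀ r₁ : ℝ} (hr₀ : 0 < r₀) (hr₁ : r₀ < r₁) :
    ∃ Mk : ℝ≥0∞, Mk ≠ ⊤ ∧ ∀ e : EuclideanSpace ℝ (Fin 3), ‖e‖ = 1 →
      eLpNorm (smoothingHessKernel r₀ r₁ e) 2 volume ≤ Mk := by
  obtain ⟨M, -, hM⟩ := exists_abs_smoothingHessKernel_le hr₀ hr₁
  have hKc : IsCompact (tsupport (newtonFarLaplacian r₀ r₁)) := hasCompactSupport_newtonFarLaplacian hr₀.le hr₁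
  refine ⟨‖M‖ₑ * volume (tsupport (newtonFarLaplacian r₀ r₁)) ^ (1 / (2 : ℝ≥0∞).toReal),
    ENNReal.mul_ne_top enorm_ne_top (ENNReal.rpow_ne_top_of_nonneg (by norm_num) hKc.measure_lt_top.ne),
    fun e he => ?_⟩
  rw [← eLpNorm_indicator_const hKc.measurableSet two_ne_zero ENNReal.ofNat_ne_top]
  refine eLpNorm_mono_real fun z => ?_
  by_cases hz : z ∈ tsupport (newtonFarLaplacian r₀ r₁)
  · rw [Set.indicator_of_mem hz, Real.norm_eq_abs]
    exact hM e he z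
  · rw [Set.indicator_of_notMem hz, smoothingHessKernel_eq_zero_of_notMem e hz, norm_zero]

/-- Cauchy–Schwarz for the reflected pairing: `‖∫ f(z)·g(x − z) dz‖ₑ ≤ ‖f‖_{L²}·‖g‖_{L²}` (the reflected
translate `z ↦ g(x − z)` has the `L²` norm of `g`: Lebesgue measure is invariant under `z ↦ x − z`). -/
theorem enorm_integral_mul_sub_le {f g : EuclideanSpace ℝ (Fin 3) → ℝ} (hf : AEStronglyMeasurable f volume)
    (hg : AEStronglyMeasurable g volume) (x : EuclideanSpace ℝ (Fin 3)) :
    ‖∫ z, f z * g (x - z)‖ₑ ≤ eLpNorm f 2 volume * eLpNorm g 2 volume := by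
  have hgx : AEStronglyMeasurable (fun z => g (x - z)) volume :=
    hg.comp_measurePreserving (Measure.measurePreserving_sub_left volume x)
  have hx2 : eLpNorm (fun z => g (x - z)) 2 volume = eLpNorm g 2 volume :=
    eLpNorm_comp_measurePreserving hg (Measure.measurePreserving_sub_left volume x)
  calc ‖∫ z, f z * g (x - z)‖ₑ ≤ ∫⁻ z, ‖f z * g (x - z)‖ₑ := enorm_integral_le_lintegral_enorm _
    _ = ∫⁻ z, ‖f z‖ₑ * ‖g (x - z)‖ₑ := by simp_rw [enorm_mul]
    _ ≤ eLpNorm f 2 volume * eLpNorm (fun z => g (x - z)) 2 volume := lintegral_enorm_mul_enorm_le hf hgx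
    _ = eLpNorm f 2 volume * eLpNorm g 2 volume := by rw [hx2]

/-! ## §4 ★ The atom, and ★★ the doors D8, D8′ closed by name -/

/-- ★ **atom B3 «HessSmoothingEnergyBound» PROVED**: for `0 < r₀ < r₁` ONE constant `C = C(r₀,r₁) ≥ 0` with
`|∫ λ_ee(z)·ϖ(v)(x − z) dz| ≤ C·(∫‖v‖² + ∫|∇v|²_F)` for every `H^∞` field `v`, every point `x` and every unit `e`
(Cauchy–Schwarz against the bounded compactly supported kernel, Stein `‖ϖ(v)‖₂ ≤ C_S‖v‖₄²`, interpolation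
`‖v‖₄⁴ ≤ ‖v‖₂‖v‖₆³`, Sobolev `‖v‖₆ ≤ C₆‖∇v‖₂`, and `max(a,b) ≤ a + b`; `C = (Mk·Cp).toReal`). -/
theorem hessSmoothingEnergyBound_holds : HessSmoothingEnergyBound := by
  unfold HessSmoothingEnergyBound
  intro r₀ r₁ hr₀ hr₁
  obtain ⟨Mk, hMk_top, hMk⟩ := exists_eLpNorm_smoothingHessKernel_le hr₀ hr₁
  obtain ⟨Cp, hCp_top, hCp⟩ := exists_eLpNorm_normalisedPressure_two_le_energy
  refine ⟨(Mk * Cp).toReal, ENNReal.toReal_nonneg, fun v hv hH x e he => ?_⟩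
  obtain ⟨hϖ, hle⟩ := hCp v hv hH
  have hA_top : ∫⁻ y, ‖v y‖ₑ ^ 2 ≠ ⊤ := (lintegral_enorm_sq_lt_top_of_sobolev hH).ne
  have hD_top : ∫⁻ y, ENNReal.ofReal (frobeniusNormSq (fderiv ℝ v y)) ≠ ⊤ :=
    (lintegral_frobeniusNormSq_fderiv_lt_top_of_sobolev hH).ne
  have hI : ‖∫ z, smoothingHessKernel r₀ r₁ e z * normalisedPressure v (x - z)‖ₑ ≤
      Mk * Cp * ((∫⁻ y, ‖v y‖ₑ ^ 2) + ∫⁻ y, ENNReal.ofReal (frobeniusNormSq (fderiv ℝ v y))) :=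
    calc ‖∫ z, smoothingHessKernel r₀ r₁ e z * normalisedPressure v (x - z)‖ₑ
        ≤ eLpNorm (smoothingHessKernel r₀ r₁ e) 2 volume * eLpNorm (normalisedPressure v) 2 volume :=
        enorm_integral_mul_sub_le (continuous_smoothingHessKernel hr₀ hr₁ e).aestronglyMeasurable hϖ.1 x
      _ ≤ Mk * (Cp * ((∫⁻ y, ‖v y‖ₑ ^ 2) + ∫⁻ y, ENNReal.ofReal (frobeniusNormSq (fderiv ℝ v y)))) :=
        mul_le_mul' (hMk e he) hle
      _ = Mk * Cp * ((∫⁻ y, ‖v y‖ₑ ^ 2) + ∫⁻ y, ENNReal.ofReal (frobeniusNormSq (fderiv ℝ v y))) :=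
        (mul_assoc _ _ _).symm
  rw [← Real.norm_eq_abs, ← toReal_enorm, integral_sq_norm_eq_toReal_of_continuous hv.continuous,
    gradNormSq_eq_toReal_of_contDiff (contDiff_infty.1 hv 1), ← ENNReal.toReal_add hA_top hD_top,
    ← ENNReal.toReal_mul]
  exact ENNReal.toReal_mono (ENNReal.mul_ne_top (ENNReal.mul_ne_top hMk_top hCp_top)
    (ENNReal.add_ne_top.2 ⟨hA_top, hD_top⟩)) hI

/-- ★★ **door D8 «LocalNewtonParityDoor» CLOSED BY NAME** (its single NS-free input B3 is now a theorem). -/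
theorem localNewtonParityDoor_holds : LocalNewtonParityDoor :=
  localNewtonParityDoor_of_B3 hessSmoothingEnergyBound_holds

/-- ★★ **door D8′ «FineStructureParityDoor» CLOSED BY NAME** (ROUND-46: D8 with the local pressure Hessian split
into its isotropic and trace-free parts; same single input B3). -/
theorem fineStructureParityDoor_holds : FineStructureParityDoor :=
  fineStructureParityDoor_of_B3 hessSmoothingEnergyBound_holds

end Summit.NavierStokesRegularity.NavierStokesRegularity.Theorems.StrainDoors

end
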